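import Literature.RepresentationTheory.HeisenbergGroup.DualLatticePair
import Literature.RepresentationTheory.HeisenbergGroup.StoneVonNeumannUniqueness
import Literature.RepresentationTheory.Unitary.CyclicCoefficientRigidity
import HarnessLib

/-!
# Stone–von Neumann uniqueness from ONE dual lattice pair: lattice-fixed vectors, the forced diagonal coefficient, and the
# unitary equivalence of any two irreducible unitary `ψ`-representations of a polarised Heisenberg group

Topic `RepresentationTheory/HeisenbergGroup`; namespace `Literature.RepresentationTheory.HeisenbergGroup`.  KERNEL ONLY:
theorems; no definition, no named fact, no record, no `sorry`.

Setting (`DualLatticePair.lean`): `R` a commutative ring, `β : X →ₗ[R] Y →ₗ[R] R` a pairing of topological additive groups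
`X`, `Y` on which the units of `R` act continuously, `ψ : R → S¹` a character, `H = Heisenberg (polar β)` the polarised
Heisenberg group (`(x, y, t)(x', y', t') = (x + x', y + y', t + t' + β x y')`), and `(B₁, B₂)` a DUAL LATTICE PAIR
(`IsDualLatticePair β ψ B₁ B₂`: compact open subgroups with `B₂ = B₁^⊥`, `B₁ = ^⊥B₂`) whose unit scalings shrink to `0`
(`∀ N ∈ 𝓝 0, ∃ a ∈ Rˣ, a B₁ ⊆ N`, and the same for `B₂`).  This is what [MoeglinVignerasWaldspurger1987, Chap. 2 I.3,
I.6–I.8] use of a `p`-adic symplectic space (`A = B₁ × B₂` a self-dual lattice, small lattices `ϖᵏ A`), and what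
[Weil1964, Chap. III n° 37–39] provides over the finite adèles (`∏_v X_v°`, scalings by non-zero integers); the tree's
`WeylPairLatticeVector.lean` / `StoneVonNeumannUniqueness.lean` are the instance `X = Y = F_vⁿ`, `B₁` the unit ball.
For representations `π` of `H` on complex Hilbert spaces by linear isometries, with continuous orbit maps `w ↦ π(w, 0) v`
on `X × Y` and central character `ψ` (`π(0, 0, t) = ψ(t)`):

* §1 **lattice-fixed vectors** (`exists_latticeFixed_ne_zero_of_isDualLatticePair`): if `E ≠ 0` some `v₀ ≠ 0` is fixed by
  `π(B₁, 0, 0)` and `π(0, B₂, 0)` — MVW I.8 "`S'(ψ_A) ≠ 0`"; proof = `WeylPairLatticeVector.exists_latticeFixed_ne_zero`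
  with the balls `B_{r₀} ⊆ B₁`, `B_{r₁} ⊆ B₁^⊥` replaced by unit scalings `a B₁ ⊆ B₁`, `b B₂ ⊆ B₂` and the two averaging
  steps supplied by `exists_sum_fixed_ne_zero_of_isDualLatticePair` for the pairs `(B₁, B₂) ≥ (a B₁, a⁻¹ B₂)` and, for the
  flipped pairing `-βᵀ`, `(B₂, B₁) ≥ (b B₂, b⁻¹ B₁)`; no Haar measure, no integral (the almost-invariant-vector lemma
  `Unitary.exists_fixed_ne_zero_of_forall_norm_sub_lt` replaces the averaging over a compact open subgroup);
* §2 **the coefficients between lattice-fixed vectors are forced** (`inner_apply_latticeFixed_latticeFixed`,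
  `inner_apply_latticeFixed_of_isDualLatticePair`): `⟪π(x, y, t) v₀, v₁⟫ = (x ∈ B₁ ∧ y ∈ B₂ ? conj ψ(t) : 0) · ⟪v₀, v₁⟫`
  for `v₀`, `v₁` lattice-fixed (MVW I.6 "`S(ψ_A)` est de dimension 1": off `B₁ × B₂` the vector `π(h) v₀` is an
  eigenvector of some `π(x', 0, 0)` or `π(0, y', 0)` with eigenvalue `≠ 1`, by the two separations of the pair, hence
  orthogonal to the fixed `v₁`); hence two lattice-fixed vectors of equal norm in two such representations have the
  same diagonal coefficient (`inner_apply_latticeFixed_eq_of_isDualLatticePair`);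
* §3 **UNIQUENESS** (`exists_linearIsometryEquiv_of_irreducible_of_isDualLatticePair`): any two such representations
  `π₁`, `π₂` on `E₁, E₂ ≠ 0` with no closed invariant subspaces other than `⊥`, `⊤` are unitarily equivalent —
  `U : E₁ ≃ₗᵢ[ℂ] E₂` with `U ∘ π₁(h) = π₂(h) ∘ U` — by the GNS rigidity of cyclic vectors with equal diagonal coefficient
  (`Unitary.exists_linearIsometryEquiv_of_irreducible`).  MODEL-FREE: no Schrödinger model, measure or `L²` space enters;
  this is the form needed on the archimedean vacuum subspace of an adelic representation, where the finite-adelic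
  Heisenberg group acts with no preferred model.

"À isomorphisme près, il existe une et une seule représentation … irréductible, telle que `ρ ∘ 𝒮(t) = ψ(t) id`"
[MoeglinVignerasWaldspurger1987, Chap. 2 I.2]; "`ρ_ψ` … (unique up to isomorphism)" [GelbartRogawski1991, §3.1 p. 454
L20–21].  Nothing of the cited sources is asserted; everything is proved from Mathlib and the tree.

## References
* [MoeglinVignerasWaldspurger1987] C. Mœglin, M.-F. Vignéras, J.-L. Waldspurger, *Correspondances de Howe sur un corps
  p-adique*, LNM 1291 (1987), Chap. 2 I.2 (Théorème), I.3, I.6, I.8.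
* [Weil1964] A. Weil, Acta Math. 111 (1964), Chap. I n° 11–12, Chap. III n° 37–39.
* [GelbartRogawski1991] S. Gelbart, J. Rogawski, Invent. Math. 105 (1991), §3.1 p. 454 L19–21.
-/

set_option autoImplicit false

noncomputable section

open Set Filter Topology
open scoped Pointwise InnerProductSpace ComplexConjugate

namespace Literature.RepresentationTheory.HeisenbergGroup

variable {R : Type*} [CommRing R] {X Y : Type*} [AddCommGroup X] [Module R X] [AddCommGroup Y] [Module R Y]
  [TopologicalSpace X] [TopologicalSpace Y] (β : X →ₗ[R] Y →ₗ[R] R) (ψ : AddChar R Circle)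
  {B₁ : AddSubgroup X} {B₂ : AddSubgroup Y}

/-- strong continuity at the origin, quantitatively: for a continuous orbit map `f` with `f 0 = v ≠ 0` and an open
subgroup `B`, the set `{x ∈ B ; ‖f x - v‖ < ‖v‖ / 2}` is a neighbourhood of `0`. [cite: MoeglinVignerasWaldspurger1987, Chap. 2 I.8] -/
theorem inter_setOf_norm_sub_lt_mem_nhds {Z : Type*} [TopologicalSpace Z] [Zero Z] {B : Set Z} (hB : IsOpen B)
    (hB0 : (0 : Z) ∈ B) {E : Type*} [NormedAddCommGroup E] {f : Z → E} (hf : Continuous f) {v : E} (hf0 : f 0 = v)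
    (hv : v ≠ 0) : B ∩ {x | ‖f x - v‖ < ‖v‖ / 2} ∈ 𝓝 (0 : Z) := by
  refine (hB.inter (isOpen_lt (hf.sub continuous_const).norm continuous_const)).mem_nhds ⟨hB0, ?_⟩
  show ‖f 0 - v‖ < ‖v‖ / 2
  rw [hf0, sub_self, norm_zero]
  exact half_pos (norm_pos_iff.2 hv)

/-! ## §1 Lattice-fixed vectors -/

section Existence

variable [IsTopologicalAddGroup X] [ContinuousConstSMul R X] [IsTopologicalAddGroup Y] [ContinuousConstSMul R Y]
  {E : Type*} [NormedAddCommGroup E] [InnerProductSpace ℂ E] [CompleteSpace E]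
  (π : Representation ℂ (Heisenberg (polar β)) E)

/-- **existence of lattice-fixed vectors.**  `(B₁, B₂)` a dual lattice pair whose unit scalings shrink to `0` in `X` and
in `Y`; `π` a representation of `Heisenberg (polar β)` on a complex Hilbert space `E ≠ 0` by linear isometries, with
continuous orbit maps `w ↦ π(w, 0) v` and central character `ψ`.  Then some `v₀ ≠ 0` satisfies `π(x, 0, 0) v₀ = v₀` for
all `x ∈ B₁` and `π(0, y, 0) v₀ = v₀` for all `y ∈ B₂` — the unitary form of "`S'(ψ_A) ≠ 0`" for the self-dual lattice
`A = B₁ × B₂`.  Step 0: a vector almost invariant under a small scaling `a B₁ ⊆ B₁` (strong continuity) is averaged to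
an `a B₁`-fixed `u ≠ 0`; step 1: the averaging over `B₁ / a B₁` gives a `B₁`-fixed `w₁ ≠ 0`; step 2: the same two moves
for the modulations inside the closed subspace of `B₁`-fixed vectors, with the flipped pairing `-βᵀ`.
[cite: MoeglinVignerasWaldspurger1987, Chap. 2 I.8] -/
theorem exists_latticeFixed_ne_zero_of_isDualLatticePair [Nontrivial E] (hB : IsDualLatticePair β ψ B₁ B₂)
    (hX : ∀ N ∈ 𝓝 (0 : X), ∃ a : Rˣ, (((a : R) • B₁ : AddSubgroup X) : Set X) ⊆ N)
    (hY : ∀ N ∈ 𝓝 (0 : Y), ∃ a : Rˣ, (((a : R) • B₂ : AddSubgroup Y) : Set Y) ⊆ N)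
    (hπu : ∀ (h : Heisenberg (polar β)) (v : E), ‖π h v‖ = ‖v‖)
    (hπc : ∀ v : E, Continuous fun w : X × Y => π ⟨w, 0⟩ v)
    (hπz : ∀ (t : R) (v : E), π (Heisenberg.ofCenter (polar β) (Multiplicative.ofAdd t)) v =
      ((ψ t : Circle) : ℂ) • v) :
    ∃ v₀ : E, v₀ ≠ 0 ∧ (∀ x ∈ B₁, π ⟨(x, 0), 0⟩ v₀ = v₀) ∧ ∀ y ∈ B₂, π ⟨(0, y), 0⟩ v₀ = v₀ := by
  classical
  -- the two abelian halves as representations of `Multiplicative X`, `Multiplicative Y`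
  let τ : Representation ℂ (Multiplicative X) E :=
    { toFun := fun x => π ⟨(Multiplicative.toAdd x, 0), 0⟩
      map_one' := by rw [toAdd_one]; exact map_one π
      map_mul' := fun a b => by rw [toAdd_mul, ← map_mul, mk_inl_mul_mk_inl] }
  let μ : Representation ℂ (Multiplicative Y) E :=
    { toFun := fun y => π ⟨(0, Multiplicative.toAdd y), 0⟩
      map_one' := by rw [toAdd_one]; exact map_one π
      map_mul' := fun a b => by rw [toAdd_mul, ← map_mul, mk_inr_mul_mk_inr] }
  have hτ : ∀ x v, τ (Multiplicative.ofAdd x) v = π ⟨(x, 0), 0⟩ v := fun x v => rfl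
  have hμ : ∀ y v, μ (Multiplicative.ofAdd y) v = π ⟨(0, y), 0⟩ v := fun y v => rfl
  have hτu : ∀ g v, ‖τ g v‖ = ‖v‖ := fun g v => hπu _ v
  have hμu : ∀ g v, ‖μ g v‖ = ‖v‖ := fun g v => hπu _ v
  -- the Weyl relations for `(τ, μ, β)` and `(μ, τ, -βᵀ)`
  have hcomm : ∀ (x : X) (y : Y) (v : E), τ (Multiplicative.ofAdd x) (μ (Multiplicative.ofAdd y) v) =
      ((ψ (β x y) : Circle) : ℂ) • μ (Multiplicative.ofAdd y) (τ (Multiplicative.ofAdd x) v) := by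
    intro x y v
    rw [hτ, hμ, hτ, hμ, apply_inl_apply_inr _ π ψ hπz]
  have hcomm' : ∀ (y : Y) (x : X) (v : E), μ (Multiplicative.ofAdd y) (τ (Multiplicative.ofAdd x) v) =
      ((ψ ((-β.flip) y x) : Circle) : ℂ) • τ (Multiplicative.ofAdd x) (μ (Multiplicative.ofAdd y) v) := by
    intro y x v
    rw [hτ, hμ, hτ, hμ, apply_inr_apply_inl _ π ψ hπz, neg_flip_apply]
  -- Step 0: a vector fixed by the translations of a small scaling `a B₁ ⊆ B₁`
  obtain ⟨v, hv⟩ := exists_ne (0 : E)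
  have hcont₁ : Continuous fun x : X => π ⟨(x, 0), 0⟩ v := (hπc v).comp (continuous_id.prodMk continuous_const)
  obtain ⟨a, ha⟩ := hX _ (inter_setOf_norm_sub_lt_mem_nhds hB.isOpen_left B₁.zero_mem hcont₁ (apply_mk_zero _ π v) hv)
  have hav : ∀ x ∈ (a : R) • B₁, ‖π ⟨(x, 0), 0⟩ v - v‖ ≤ ‖v‖ / 2 := fun x hx => le_of_lt (ha hx).2
  obtain ⟨u, -, hu0, hu⟩ := Unitary.exists_fixed_ne_zero_of_forall_norm_sub_lt τ hτu
    (AddSubgroup.toSubgroup ((a : R) • B₁)) ⊤ isClosed_univ (fun _ _ _ _ => Submodule.mem_top)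
    (Submodule.mem_top : v ∈ (⊤ : Submodule ℂ E)) (half_lt_self (norm_pos_iff.2 hv)) (fun g hg => by
      rw [Multiplicative.mem_toSubgroup] at hg
      exact hav (Multiplicative.toAdd g) hg)
  have hu' : ∀ x ∈ (a : R) • B₁, τ (Multiplicative.ofAdd x) u = u := fun x hx =>
    hu (Multiplicative.ofAdd x) (by rw [Multiplicative.mem_toSubgroup]; exact hx)
  -- Step 1: the averaging step for `(τ, μ, β)` and the pairs `(B₁, B₂)`, `(a B₁, a⁻¹ B₂)`, `W = ⊤`
  obtain ⟨w₁, -, hw₁0, hw₁⟩ := exists_sum_fixed_ne_zero_of_isDualLatticePair β ψ τ μ hcomm hB (hB.smul a) ⊤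
    (fun _ _ _ _ => Submodule.mem_top) (fun _ _ _ _ => Submodule.mem_top) Submodule.mem_top hu0 hu'
  -- the closed subspace `W` of `B₁`-fixed vectors
  set W : Submodule ℂ E := ⨅ x ∈ (B₁ : Set X), LinearMap.ker (π ⟨(x, 0), 0⟩ - 1) with hWdef
  have hmemW : ∀ w : E, w ∈ W ↔ ∀ x ∈ B₁, π ⟨(x, 0), 0⟩ w = w := by
    intro w
    simp only [hWdef, Submodule.mem_iInf, LinearMap.mem_ker, LinearMap.sub_apply, Module.End.one_apply, sub_eq_zero,
      SetLike.mem_coe]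
  have hWc : IsClosed (W : Set E) := by
    have e : (W : Set E) = ⋂ x ∈ (B₁ : Set X), {w : E | π ⟨(x, 0), 0⟩ w = w} := by
      ext w
      simp only [SetLike.mem_coe, hmemW, Set.mem_iInter, Set.mem_setOf_eq]
    rw [e]
    exact isClosed_biInter fun x _ => isClosed_eq
      (AddMonoidHomClass.continuous_of_bound (π ⟨(x, 0), 0⟩) 1 fun w => by rw [hπu, one_mul]) continuous_id
  have hw₁W : w₁ ∈ W := (hmemW w₁).2 hw₁
  -- `μ_y` preserves `W` for `y ∈ B₂`; `τ_x` preserves `W` for every `x`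
  have hWμ : ∀ y ∈ B₂, ∀ w ∈ W, μ (Multiplicative.ofAdd y) w ∈ W := by
    intro y hy w hw
    rw [hmemW] at hw ⊢
    intro x hx
    rw [← hτ, hcomm, hτ, hw x hx, hB.apply_eq_one hx hy, Circle.coe_one, one_smul]
  have hWτ : ∀ (x : X), ∀ w ∈ W, τ (Multiplicative.ofAdd x) w ∈ W := by
    intro x w hw
    rw [hmemW] at hw ⊢
    intro x' hx'
    rw [← hτ x', ← Module.End.mul_apply, ← map_mul, ← ofAdd_add, add_comm, ofAdd_add, map_mul, Module.End.mul_apply,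
      hτ x', hw x' hx']
  -- Step 2a: inside `W`, a vector fixed by the modulations of a small scaling `b B₂ ⊆ B₂`
  have hcont₂ : Continuous fun y : Y => π ⟨(0, y), 0⟩ w₁ := (hπc w₁).comp (continuous_const.prodMk continuous_id)
  obtain ⟨b, hb⟩ := hY _ (inter_setOf_norm_sub_lt_mem_nhds hB.isOpen_right B₂.zero_mem hcont₂ (apply_mk_zero _ π w₁) hw₁0)
  have hbB : (b : R) • B₂ ≤ B₂ := fun y hy => (hb hy).1
  have hbv : ∀ y ∈ (b : R) • B₂, ‖π ⟨(0, y), 0⟩ w₁ - w₁‖ ≤ ‖w₁‖ / 2 := fun y hy => le_of_lt (hb hy).2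
  obtain ⟨u₂, hu₂W, hu₂0, hu₂⟩ := Unitary.exists_fixed_ne_zero_of_forall_norm_sub_lt μ hμu
    (AddSubgroup.toSubgroup ((b : R) • B₂)) W hWc
    (fun g hg w hw => hWμ _ (hbB ((Multiplicative.mem_toSubgroup _ _).1 hg)) w hw) hw₁W
    (half_lt_self (norm_pos_iff.2 hw₁0)) (fun g hg => by
      rw [Multiplicative.mem_toSubgroup] at hg
      exact hbv (Multiplicative.toAdd g) hg)
  have hu₂' : ∀ y ∈ (b : R) • B₂, μ (Multiplicative.ofAdd y) u₂ = u₂ := fun y hy =>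
    hu₂ (Multiplicative.ofAdd y) (by rw [Multiplicative.mem_toSubgroup]; exact hy)
  -- Step 2b: the averaging step for `(μ, τ, -βᵀ)` and the pairs `(B₂, B₁)`, `(b B₂, b⁻¹ B₁)`, inside `W`
  obtain ⟨v₀, hv₀W, hv₀0, hv₀⟩ := exists_sum_fixed_ne_zero_of_isDualLatticePair (-β.flip) ψ μ τ hcomm' hB.flip
    (hB.smul_inv b).flip W (fun y hy w hw => hWμ y hy w hw) (fun x _ w hw => hWτ x w hw) hu₂W hu₂0 hu₂'
  refine ⟨v₀, hv₀0, fun x hx => ?_, fun y hy => ?_⟩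
  · exact ((hmemW v₀).1 hv₀W) x hx
  · rw [← hμ]
    exact hv₀ y hy

end Existence

/-! ## §2 The diagonal coefficient of a lattice-fixed vector is forced -/

section Coefficient

variable {E : Type*} [NormedAddCommGroup E] [InnerProductSpace ℂ E] (π : Representation ℂ (Heisenberg (polar β)) E)
  (hπu : ∀ (h : Heisenberg (polar β)) (v : E), ‖π h v‖ = ‖v‖)
  (hπz : ∀ (t : R) (v : E), π (Heisenberg.ofCenter (polar β) (Multiplicative.ofAdd t)) v = ((ψ t : Circle) : ℂ) • v)
  {v₀ v₁ : E} (hτ₀ : ∀ x ∈ B₁, π ⟨(x, 0), 0⟩ v₀ = v₀) (hμ₀ : ∀ y ∈ B₂, π ⟨(0, y), 0⟩ v₀ = v₀)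
  (hτ₁ : ∀ x ∈ B₁, π ⟨(x, 0), 0⟩ v₁ = v₁) (hμ₁ : ∀ y ∈ B₂, π ⟨(0, y), 0⟩ v₁ = v₁)
include hπu hπz hτ₀ hμ₀ hτ₁ hμ₁

omit hμ₀ hμ₁ in
/-- off the lattice in the `y`-variable the coefficient vanishes: if `y ∉ B₂`, some `x' ∈ B₁` has `ψ(β x' y) ≠ 1`, and
`π(x, y, t) v₀` is an eigenvector of `π(x', 0, 0)` with that eigenvalue, hence orthogonal to the fixed vector `v₁`.
[cite: MoeglinVignerasWaldspurger1987, Chap. 2 I.6] -/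
theorem inner_apply_eq_zero_of_not_mem_right (hB : IsDualLatticePair β ψ B₁ B₂) (x : X) (y : Y) (t : R)
    (hy : y ∉ B₂) : ⟪π ⟨(x, y), t⟩ v₀, v₁⟫_ℂ = 0 := by
  obtain ⟨x', hx', hne⟩ := hB.exists_left_ne_one hy
  refine inner_eq_zero_of_apply_eq_smul (U := π ⟨(x', 0), 0⟩) (Unitary.inner_apply_apply π hπu _)
    (c := ((ψ (β x' y) : Circle) : ℂ)) ?_ (hτ₁ x' hx') (by rwa [Ne, Circle.coe_eq_one])
  rw [apply_mk_eq _ π ψ hπz x y t, map_smul, ← Module.End.mul_apply (π ⟨(x', 0), 0⟩), ← map_mul, mk_inl_mul_mk_inl,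
    add_comm, ← mk_inl_mul_mk_inl, map_mul, Module.End.mul_apply, apply_inl_apply_inr _ π ψ hπz, hτ₀ x' hx', map_smul,
    smul_comm]

omit hτ₀ hτ₁ in
/-- off the lattice in the `x`-variable the coefficient vanishes: if `x ∉ B₁`, separation gives `y' ∈ B₂` with
`ψ(β x y') ≠ 1`, and `π(x, y, t) v₀` is an eigenvector of `π(0, y', 0)` with eigenvalue `ψ(β x y')⁻¹ ≠ 1`, hence
orthogonal to the fixed vector `v₁`. [cite: MoeglinVignerasWaldspurger1987, Chap. 2 I.6] -/
theorem inner_apply_eq_zero_of_not_mem_left (hB : IsDualLatticePair β ψ B₁ B₂) (x : X) (y : Y) (t : R)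
    (hx : x ∉ B₁) : ⟪π ⟨(x, y), t⟩ v₀, v₁⟫_ℂ = 0 := by
  obtain ⟨y', hy', hne⟩ := hB.exists_right_ne_one hx
  refine inner_eq_zero_of_apply_eq_smul (U := π ⟨(0, y'), 0⟩) (Unitary.inner_apply_apply π hπu _)
    (c := ((ψ (-(β x y')) : Circle) : ℂ)) ?_ (hμ₁ y' hy') ?_
  · rw [apply_mk_eq _ π ψ hπz x y t, map_smul, apply_inr_apply_inl _ π ψ hπz,
      ← Module.End.mul_apply (π ⟨(0, y'), 0⟩), ← map_mul, mk_inr_mul_mk_inr, add_comm, ← mk_inr_mul_mk_inr, map_mul,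
      Module.End.mul_apply, hμ₀ y' hy', smul_comm]
  · rwa [Ne, Circle.coe_eq_one, AddChar.map_neg_eq_inv, inv_eq_one]

omit hπu hτ₁ hμ₁ in
/-- on the lattice the coefficient is `conj ψ(t) ⟪v₀, v₁⟫`: for `x ∈ B₁`, `y ∈ B₂`, `π(x, y, t) v₀ = ψ(t) v₀`.
[cite: MoeglinVignerasWaldspurger1987, Chap. 2 I.6] -/
theorem inner_apply_of_mem_of_mem (hB : IsDualLatticePair β ψ B₁ B₂) (x : X) (y : Y) (t : R) (hx : x ∈ B₁)
    (hy : y ∈ B₂) : ⟪π ⟨(x, y), t⟩ v₀, v₁⟫_ℂ = conj ((ψ t : Circle) : ℂ) * ⟪v₀, v₁⟫_ℂ := by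
  rw [apply_mk_eq _ π ψ hπz x y t, hμ₀ y hy, hτ₀ x hx, AddChar.map_sub_eq_div, hB.apply_eq_one hx hy, div_one,
    inner_smul_left]

/-- **the coefficients between lattice-fixed vectors are forced**: for `v₀`, `v₁` both fixed by `π(B₁, 0, 0)` and
`π(0, B₂, 0)`, `⟪π(x, y, t) v₀, v₁⟫ = (if x ∈ B₁ ∧ y ∈ B₂ then conj ψ(t) else 0) · ⟪v₀, v₁⟫` — it depends on `π` only
through `⟪v₀, v₁⟫` (MVW I.6: "`S(ψ_A)` est de dimension 1"; I.8: the function `f_A = ψ̄_A · 1_{A_H}`).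
[cite: MoeglinVignerasWaldspurger1987, Chap. 2 I.8] -/
theorem inner_apply_latticeFixed_latticeFixed (hB : IsDualLatticePair β ψ B₁ B₂) (h : Heisenberg (polar β)) :
    haveI := Classical.propDecidable
    ⟪π h v₀, v₁⟫_ℂ = (if h.v.1 ∈ B₁ ∧ h.v.2 ∈ B₂ then conj ((ψ h.t : Circle) : ℂ) else 0) * ⟪v₀, v₁⟫_ℂ := by
  haveI := Classical.propDecidable
  obtain ⟨⟨x, y⟩, t⟩ := h
  dsimp only
  split_ifs with hxy
  · exact inner_apply_of_mem_of_mem β ψ π hπz hτ₀ hμ₀ hB x y t hxy.1 hxy.2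
  · rw [zero_mul]
    by_cases hy : y ∈ B₂
    · exact inner_apply_eq_zero_of_not_mem_left β ψ π hπu hπz hμ₀ hμ₁ hB x y t fun hx => hxy ⟨hx, hy⟩
    · exact inner_apply_eq_zero_of_not_mem_right β ψ π hπu hπz hτ₀ hτ₁ hB x y t hy

omit hτ₁ hμ₁ in
/-- **the diagonal coefficient of a lattice-fixed vector is forced**: for `v₀` fixed by `π(B₁, 0, 0)` and `π(0, B₂, 0)`,
`⟪π(x, y, t) v₀, v₀⟫ = (if x ∈ B₁ ∧ y ∈ B₂ then conj ψ(t) else 0) · ⟪v₀, v₀⟫` — it depends on `π` only through `‖v₀‖`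
(MVW I.8: the function `f_A = ψ̄_A · 1_{A_H}`). [cite: MoeglinVignerasWaldspurger1987, Chap. 2 I.8] -/
theorem inner_apply_latticeFixed_of_isDualLatticePair (hB : IsDualLatticePair β ψ B₁ B₂) (h : Heisenberg (polar β)) :
    haveI := Classical.propDecidable
    ⟪π h v₀, v₀⟫_ℂ = (if h.v.1 ∈ B₁ ∧ h.v.2 ∈ B₂ then conj ((ψ h.t : Circle) : ℂ) else 0) * ⟪v₀, v₀⟫_ℂ :=
  inner_apply_latticeFixed_latticeFixed β ψ π hπu hπz hτ₀ hμ₀ hτ₀ hμ₀ hB h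

end Coefficient

/-- **two lattice-fixed vectors of the same norm have the same diagonal coefficient**, in any two isometric
`ψ`-representations of `H`. [cite: MoeglinVignerasWaldspurger1987, Chap. 2 I.8] -/
theorem inner_apply_latticeFixed_eq_of_isDualLatticePair (hB : IsDualLatticePair β ψ B₁ B₂)
    {E₁ : Type*} [NormedAddCommGroup E₁] [InnerProductSpace ℂ E₁] {E₂ : Type*} [NormedAddCommGroup E₂]
    [InnerProductSpace ℂ E₂] (π₁ : Representation ℂ (Heisenberg (polar β)) E₁)
    (π₂ : Representation ℂ (Heisenberg (polar β)) E₂)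
    (h₁u : ∀ (h : Heisenberg (polar β)) (v : E₁), ‖π₁ h v‖ = ‖v‖)
    (h₁z : ∀ (t : R) (v : E₁), π₁ (Heisenberg.ofCenter (polar β) (Multiplicative.ofAdd t)) v = ((ψ t : Circle) : ℂ) • v)
    (h₂u : ∀ (h : Heisenberg (polar β)) (v : E₂), ‖π₂ h v‖ = ‖v‖)
    (h₂z : ∀ (t : R) (v : E₂), π₂ (Heisenberg.ofCenter (polar β) (Multiplicative.ofAdd t)) v = ((ψ t : Circle) : ℂ) • v)
    {v₁ : E₁} {v₂ : E₂} (h₁τ : ∀ x ∈ B₁, π₁ ⟨(x, 0), 0⟩ v₁ = v₁) (h₁μ : ∀ y ∈ B₂, π₁ ⟨(0, y), 0⟩ v₁ = v₁)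
    (h₂τ : ∀ x ∈ B₁, π₂ ⟨(x, 0), 0⟩ v₂ = v₂) (h₂μ : ∀ y ∈ B₂, π₂ ⟨(0, y), 0⟩ v₂ = v₂)
    (hnorm : ‖v₁‖ = ‖v₂‖) (h : Heisenberg (polar β)) :
    ⟪π₁ h v₁, v₁⟫_ℂ = ⟪π₂ h v₂, v₂⟫_ℂ := by
  have hvv : ⟪v₁, v₁⟫_ℂ = ⟪v₂, v₂⟫_ℂ := by
    rw [inner_self_eq_norm_sq_to_K, inner_self_eq_norm_sq_to_K, hnorm]
  rw [inner_apply_latticeFixed_of_isDualLatticePair β ψ π₁ h₁u h₁z h₁τ h₁μ hB h,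
    inner_apply_latticeFixed_of_isDualLatticePair β ψ π₂ h₂u h₂z h₂τ h₂μ hB h, hvv]

/-! ## §3 The uniqueness theorem -/

section Uniqueness

variable [IsTopologicalAddGroup X] [ContinuousConstSMul R X] [IsTopologicalAddGroup Y] [ContinuousConstSMul R Y]

/-- **Stone–von Neumann, uniqueness (unitary form, from one dual lattice pair).**  `(B₁, B₂)` a dual lattice pair for
`ψ(β x y)` whose unit scalings shrink to `0` in `X` and in `Y`.  Let `π₁`, `π₂` be representations of
`H = Heisenberg (polar β)` on complex Hilbert spaces `E₁, E₂ ≠ 0` such that every `πᵢ(h)` is an isometry, the orbit maps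
`w ↦ πᵢ(w, 0) v` are continuous on `X × Y`, the centre acts by `ψ` (`πᵢ(0, 0, t) = ψ(t)`), and the only closed
`πᵢ`-invariant subspaces are `⊥` and `⊤`.  Then `π₁` and `π₂` are unitarily equivalent: there is a unitary
`U : E₁ ≃ₗᵢ[ℂ] E₂` with `U (π₁ h v) = π₂ h (U v)` for all `h`, `v` — "à isomorphisme près … une et une seule
représentation irréductible telle que `ρ ∘ 𝒮(t) = ψ(t) id`", here for any polarised Heisenberg group carrying a dual
lattice pair (every finite place; the finite adèles).
[cite: MoeglinVignerasWaldspurger1987, Chap. 2 I.2 Théorème (Stone, Von Neumann)] -/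
theorem exists_linearIsometryEquiv_of_irreducible_of_isDualLatticePair (hB : IsDualLatticePair β ψ B₁ B₂)
    (hX : ∀ N ∈ 𝓝 (0 : X), ∃ a : Rˣ, (((a : R) • B₁ : AddSubgroup X) : Set X) ⊆ N)
    (hY : ∀ N ∈ 𝓝 (0 : Y), ∃ a : Rˣ, (((a : R) • B₂ : AddSubgroup Y) : Set Y) ⊆ N)
    {E₁ : Type*} [NormedAddCommGroup E₁] [InnerProductSpace ℂ E₁] [CompleteSpace E₁] [Nontrivial E₁]
    {E₂ : Type*} [NormedAddCommGroup E₂] [InnerProductSpace ℂ E₂] [CompleteSpace E₂] [Nontrivial E₂]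
    (π₁ : Representation ℂ (Heisenberg (polar β)) E₁) (π₂ : Representation ℂ (Heisenberg (polar β)) E₂)
    (h₁u : ∀ (h : Heisenberg (polar β)) (v : E₁), ‖π₁ h v‖ = ‖v‖)
    (h₁c : ∀ v : E₁, Continuous fun w : X × Y => π₁ ⟨w, 0⟩ v)
    (h₁z : ∀ (t : R) (v : E₁), π₁ (Heisenberg.ofCenter (polar β) (Multiplicative.ofAdd t)) v = ((ψ t : Circle) : ℂ) • v)
    (h₁i : ∀ K : Submodule ℂ E₁, IsClosed (K : Set E₁) →
      (∀ (h : Heisenberg (polar β)), ∀ v ∈ K, π₁ h v ∈ K) → K = ⊥ ∨ K = ⊤)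
    (h₂u : ∀ (h : Heisenberg (polar β)) (v : E₂), ‖π₂ h v‖ = ‖v‖)
    (h₂c : ∀ v : E₂, Continuous fun w : X × Y => π₂ ⟨w, 0⟩ v)
    (h₂z : ∀ (t : R) (v : E₂), π₂ (Heisenberg.ofCenter (polar β) (Multiplicative.ofAdd t)) v = ((ψ t : Circle) : ℂ) • v)
    (h₂i : ∀ K : Submodule ℂ E₂, IsClosed (K : Set E₂) →
      (∀ (h : Heisenberg (polar β)), ∀ v ∈ K, π₂ h v ∈ K) → K = ⊥ ∨ K = ⊤) :
    ∃ U : E₁ ≃ₗᵢ[ℂ] E₂, ∀ (h : Heisenberg (polar β)) (v : E₁), U (π₁ h v) = π₂ h (U v) := by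
  -- lattice-fixed vectors on both sides, the second rescaled to the norm of the first
  obtain ⟨v₁, hv₁0, hv₁τ, hv₁μ⟩ := exists_latticeFixed_ne_zero_of_isDualLatticePair β ψ π₁ hB hX hY h₁u h₁c h₁z
  obtain ⟨v₀, hv₀0, hv₀τ, hv₀μ⟩ := exists_latticeFixed_ne_zero_of_isDualLatticePair β ψ π₂ hB hX hY h₂u h₂c h₂z
  set c : ℂ := ((‖v₁‖ / ‖v₀‖ : ℝ) : ℂ) with hc
  have hcpos : 0 < ‖v₁‖ / ‖v₀‖ := div_pos (norm_pos_iff.2 hv₁0) (norm_pos_iff.2 hv₀0)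
  set v₂ : E₂ := c • v₀ with hv₂
  have hv₂0 : v₂ ≠ 0 := smul_ne_zero (by rw [hc]; exact_mod_cast hcpos.ne') hv₀0
  have hv₂τ : ∀ x ∈ B₁, π₂ ⟨(x, 0), 0⟩ v₂ = v₂ := fun x hx => by rw [hv₂, map_smul, hv₀τ x hx]
  have hv₂μ : ∀ y ∈ B₂, π₂ ⟨(0, y), 0⟩ v₂ = v₂ := fun y hy => by rw [hv₂, map_smul, hv₀μ y hy]
  have hnorm : ‖v₁‖ = ‖v₂‖ := by
    rw [hv₂, norm_smul, hc, Complex.norm_real, Real.norm_of_nonneg hcpos.le, div_mul_cancel₀ _ (norm_ne_zero_iff.2 hv₀0)]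
  -- equal diagonal coefficients, irreducibility on both sides ⇒ unitary equivalence
  have hcoef : ∀ h : Heisenberg (polar β), ⟪π₁ h v₁, v₁⟫_ℂ = ⟪π₂ h v₂, v₂⟫_ℂ :=
    inner_apply_latticeFixed_eq_of_isDualLatticePair β ψ hB π₁ π₂ h₁u h₁z h₂u h₂z hv₁τ hv₁μ hv₂τ hv₂μ hnorm
  obtain ⟨U, -, hU⟩ := Unitary.exists_linearIsometryEquiv_of_irreducible π₁ π₂ h₁u h₂u h₁i h₂i hv₁0 hv₂0 hcoef
  exact ⟨U, hU⟩

end Uniqueness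

end Literature.RepresentationTheory.HeisenbergGroup

end
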